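import Mathlib
import Summits.AtomisticToContinuum.HydrodynamicLimit.Theorems.ImplosionDichotomyDenseExcursionSonicSmoothBranchCkSonicPair
import Summits.AtomisticToContinuum.HydrodynamicLimit.Theorems.ImplosionDichotomyDenseExcursionSonicSmoothBranchGapPair

/-!
# The Frobenius pair of the characteristic system at the sonic point under a quantified gap `‖n ∓ ν(Λ)‖ ≥ μ`
# (crux `DenseExcursion`, line `sonic-cavity-renewal`, brick for stub `stub_cavityResolventCk`, theorem T2/T6b)

Helper file (`--supports stmt-AtomisticToContinuum-12586`, line lead a2, stub-worker E1 for `stub_cavityResolventCk`).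
Verbatim the instantiation `sonic_frobenius_pair` (`…SonicSmoothBranchCkSonicPair`) of the abstract Frobenius pair with
the power series of the characteristic system of a monatomic tube profile at its sonic point
(`sonic_coefficient_series`), with the single change that the off-axis hypothesis `|Im Λ| ≥ 1` (which served only to
quantify the non-resonance `|Im ν| ≥ 4/7`) is replaced by the GAP HYPOTHESIS on the Frobenius exponent
`ν(Λ) = (b₊₊(0) − Λ)/κ`: `‖n − ν(Λ)‖ ≥ μ` and `‖n + ν(Λ)‖ ≥ μ` for all `n : ℕ`, for a parameter `μ > 0` on which the radius
and the bounds may depend (abstract pair: `frobenius_pair_of_series_gap`). Registered helper `sonic_frobenius_pair_gap`.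
This covers every `Λ` whose exponent is not an integer, in particular the real spectral parameters of the cavity
resolvent off the discrete set `ν(Λ) ∈ ℤ`. Sources: Coddington–Levinson 1955 Ch. 4 (folklore).
-/

noncomputable section

open Set Filter
open scoped Topology ContDiff

namespace Summit.AtomisticToContinuum.HydrodynamicLimit.Theorems.SonicCavityRenewal

open Summit.AtomisticToContinuum.HydrodynamicLimit.Theorems.R2OneModeTwoConditions

/-- **Registered helper `sonic_frobenius_pair_gap`: THE FROBENIUS PAIR OF THE CHARACTERISTIC SYSTEM OF A TUBE PROFILE AT
THE SONIC POINT UNDER A QUANTIFIED GAP, UNIFORMLY IN `Λ`.** See the module docstring. [folklore] -/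
theorem sonic_frobenius_pair_gap : ∀ (r : ℝ) (W S : ℝ → ℝ), IsMonatomicProfile r W S → CavityTube r W S → ∀ (k : ℕ) (R μ : ℝ), 0 < μ → ∃ ρ : ℝ, 0 < ρ ∧ ρ ≤ 1 ∧ (∀ x : ℝ, x * dslope (fun y => W y - 1 + S y) 0 x = W x - 1 + S x) ∧ dslope (fun y => W y - 1 + S y) 0 0 = deriv W 0 + deriv S 0 ∧ deriv W 0 + deriv S 0 ≤ -(2 / 5) ∧ -(7 / 4) ≤ deriv W 0 + deriv S 0 ∧ (∀ x ∈ Set.Ioo (-ρ) ρ, dslope (fun y => W y - 1 + S y) 0 x ≠ 0 ∧ W x - 1 - S x < 0) ∧ ∃ Cb : ℝ, 0 ≤ Cb ∧ (∃ ι₁ ι₂ : ℝ → ℂ, ContDiffOn ℝ ∞ ι₁ (Set.Ioo (-ρ) ρ) ∧ ContDiffOn ℝ ∞ ι₂ (Set.Ioo (-ρ) ρ) ∧ (∀ x ∈ Set.Ioo (-ρ) ρ, ι₁ x = ((1 / dslope (fun y => W y - 1 + S y) 0 x : ℝ) : ℂ) ∧ ι₂ x = ((1 / (W x - 1 - S x)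 : ℝ) : ℂ)) ∧ ∀ i : ℕ, i ≤ k → ∀ x ∈ Set.Ioo (-ρ) ρ, ‖iteratedDeriv i ι₁ x‖ ≤ Cb ∧ ‖iteratedDeriv i ι₂ x‖ ≤ Cb) ∧ ∀ Λ : ℂ, ‖Λ‖ ≤ R → (∀ n : ℕ, μ ≤ ‖(n : ℂ) - ((((2 / 3 * deriv W 0 + 2 * deriv S 0 + 2 * W 0 + 4 * S 0 - r : ℝ) : ℂ) - Λ) / ((-(deriv W 0 + deriv S 0) : ℝ) : ℂ))‖ ∧ μ ≤ ‖(n : ℂ) + ((((2 / 3 * deriv W 0 + 2 * deriv S 0 + 2 * W 0 + 4 * S 0 - r : ℝ) : ℂ) - Λ) / ((-(deriv W 0 + deriv S 0) : ℝ) : ℂ))‖) → ∃ (a₁ a₂ ψ₁ ψ₂ χ : ℝ → ℂ), ContDiffOn ℝ ∞ a₁ (Set.Ioo (-ρ) ρ) ∧ ContDiffOn ℝ ∞ a₂ (Set.Ioo (-ρ) ρ) ∧ ContDiffOn ℝ ∞ ψ₁ (Set.Ioo (-ρ) ρ) ∧ ContDiffOn ℝ ∞ ψ₂ (Set.Ioo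 (-ρ) ρ) ∧ ContDiffOn ℝ ∞ χ (Set.Ioo (-ρ) ρ) ∧ a₂ 0 = 1 ∧ ψ₁ 0 = 1 ∧ (∀ x ∈ Set.Ioo (-ρ) ρ, ψ₂ x = (x : ℂ) * χ x) ∧ (∀ x ∈ Set.Ioo (-ρ) ρ, ((x : ℂ) * deriv a₁ x = (Λ - ((2 / 3 * deriv W x + 2 * W x - r + 2 * deriv S x + 4 * S x : ℝ) : ℂ)) / ((dslope (fun y => W y - 1 + S y) 0 x : ℝ) : ℂ) * a₁ x + (-((deriv W x / 3 + deriv S x + 2 * S x : ℝ) : ℂ) / ((dslope (fun y => W y - 1 + S y) 0 x : ℝ) : ℂ)) * a₂ x ∧ (x : ℂ) * deriv a₂ x = (-(x : ℂ) * ((deriv W x / 3 - deriv S x - 2 * S x : ℝ) : ℂ) / ((W x - 1 - S x : ℝ) : ℂ)) * a₁ x + ((x : ℂ) * (Λ - ((2 / 3 * deriv W x + 2 * W x - r - 2 * deriv S x - 4 * S x : ℝ) : ℂ)) / ((W x - 1 - S x : ℝ) : ℂ)) * a₂ x) ∧ ((x : ℂ) * deriv ψ₁ x = ((Λ - ((2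 / 3 * deriv W x + 2 * W x - r + 2 * deriv S x + 4 * S x : ℝ) : ℂ)) / ((dslope (fun y => W y - 1 + S y) 0 x : ℝ) : ℂ) - ((((2 / 3 * deriv W 0 + 2 * deriv S 0 + 2 * W 0 + 4 * S 0 - r : ℝ) : ℂ) - Λ) / ((-(deriv W 0 + deriv S 0) : ℝ) : ℂ))) * ψ₁ x + (-((deriv W x / 3 + deriv S x + 2 * S x : ℝ) : ℂ) / ((dslope (fun y => W y - 1 + S y) 0 x : ℝ) : ℂ)) * ψ₂ x ∧ (x : ℂ) * deriv ψ₂ x = (-(x : ℂ) * ((deriv W x / 3 - deriv S x - 2 * S x : ℝ) : ℂ) / ((W x - 1 - S x : ℝ) : ℂ)) * ψ₁ x + ((x : ℂ) * (Λ - ((2 / 3 * deriv W x + 2 * W x - r - 2 * deriv S x - 4 * S x : ℝ) : ℂ)) / ((W x - 1 - S x : ℝ) : ℂ) - ((((2 / 3 * deriv W 0 + 2 * deriv S 0 + 2 * W 0 + 4 * S 0 - r : ℝ) : ℂ) - Λ) / ((-(deriv W 0 + deriv S 0) : ℝ) : ℂ))) * ψ₂ x)) ∧ (∀ x ∈ Set.Ioo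 (-ρ) ρ, ‖a₁ x * ψ₂ x - a₂ x * ψ₁ x + 1‖ ≤ 1 / 2) ∧ ∀ i : ℕ, i ≤ k → ∀ x ∈ Set.Ioo (-ρ) ρ, ‖iteratedDeriv i a₁ x‖ ≤ Cb ∧ ‖iteratedDeriv i a₂ x‖ ≤ Cb ∧ ‖iteratedDeriv i ψ₁ x‖ ≤ Cb ∧ ‖iteratedDeriv i ψ₂ x‖ ≤ Cb ∧ ‖iteratedDeriv i χ x‖ ≤ Cb := by
  intro r W S hP hT k R μ hμpos
  -- the coefficient series
  obtain ⟨ρ₀, hρ₀, hρ₀1, hxη, hη0, hκ, hκ', hbpm, hne, C₀, θ, e, hC₀, hθ, he, hser⟩ := sonic_coefficient_series r W S hP hT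
  have h0 : (0 : ℝ) ∈ Ioo (-ρ₀) ρ₀ := ⟨by linarith, hρ₀⟩
  obtain ⟨s0, s1, s2, s3, s4, s5, s6⟩ := hser 0 h0
  have e00 := eq_of_hasSum_at_zero s0
  have e10 := eq_of_hasSum_at_zero s1
  have e20 := eq_of_hasSum_at_zero s2
  have e30 := eq_of_hasSum_at_zero s3
  have e40 := eq_of_hasSum_at_zero s4
  have e50 := eq_of_hasSum_at_zero s5
  rw [hη0] at e00 e20 e30
  simp only [zero_mul, zero_div] at e10 e40 e50
  obtain ⟨κ, hκ_def⟩ : ∃ κ : ℝ, κ = -(deriv W 0 + deriv S 0) := ⟨_, rfl⟩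
  have hκpos : 0 < κ := by rw [hκ_def]; linarith
  have hκ25 : 2 / 5 ≤ κ := by rw [hκ_def]; linarith
  have hκle : κ ≤ 7 / 4 := by rw [hκ_def]; linarith
  have hηκ : deriv W 0 + deriv S 0 = -κ := by rw [hκ_def]; ring
  obtain ⟨b₀, hb₀⟩ : ∃ b₀ : ℝ, b₀ = 2 / 3 * deriv W 0 + 2 * deriv S 0 + 2 * W 0 + 4 * S 0 - r := ⟨_, rfl⟩
  -- the constants of the abstract pair theorem
  obtain ⟨ρ₁, hρ₁, Cb₁, hCb₁, hpair⟩ := frobenius_pair_of_series_gap C₀ θ (max R 0) μ ((|b₀| + max R 0) * (5 / 2)) (15 / 4) k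
    hC₀ hθ (le_max_right _ _) hμpos (by positivity) (by norm_num)
  -- the packages of the two inverse speeds
  obtain ⟨Cs, hCs0, hCs⟩ := scalar_series_package θ k hθ
  have hce : ∀ i n, ‖((e i n : ℝ) : ℂ)‖ ≤ C₀ * θ ^ n := fun i n => by
    rw [Complex.norm_real, Real.norm_eq_abs]; exact he i n
  obtain ⟨hι₁C, -, hι₁b⟩ := hCs (fun n => ((e 0 n : ℝ) : ℂ)) C₀ (hce 0)
  obtain ⟨hι₂C, -, hι₂b⟩ := hCs (fun n => ((e 6 n : ℝ) : ℂ)) C₀ (hce 6)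
  -- the radius
  obtain ⟨ρ, hρ⟩ : ∃ ρ : ℝ, ρ = min ρ₀ (min ρ₁ (1 / (2 ^ (k + 1) * θ))) := ⟨_, rfl⟩
  have hρpos : 0 < ρ := by rw [hρ]; exact lt_min hρ₀ (lt_min hρ₁ (by positivity))
  have hρρ₀ : ρ ≤ ρ₀ := by rw [hρ]; exact min_le_left _ _
  have hρρ₁ : ρ ≤ ρ₁ := by rw [hρ]; exact (min_le_right _ _).trans (min_le_left _ _)
  have hρθ : ρ ≤ 1 / (2 ^ (k + 1) * θ) := by rw [hρ]; exact (min_le_right _ _).trans (min_le_right _ _)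
  have sub₀ : Ioo (-ρ) ρ ⊆ Ioo (-ρ₀) ρ₀ := fun x hx => ⟨by linarith [hx.1], hx.2.trans_le hρρ₀⟩
  have sub₁ : Ioo (-ρ) ρ ⊆ Ioo (-ρ₁) ρ₁ := fun x hx => ⟨by linarith [hx.1], hx.2.trans_le hρρ₁⟩
  have subθ : Ioo (-ρ) ρ ⊆ Ioo (-(1 / (2 ^ (k + 1) * θ))) (1 / (2 ^ (k + 1) * θ)) :=
    fun x hx => ⟨by linarith [hx.1], hx.2.trans_le hρθ⟩
  have hιeq : ∀ x ∈ Ioo (-ρ) ρ, (∑' n, (x : ℂ) ^ n • ((e 0 n : ℝ) : ℂ)) = ((1 / dslope (fun y => W y - 1 + S y) 0 x : ℝ) : ℂ) ∧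
      (∑' n, (x : ℂ) ^ n • ((e 6 n : ℝ) : ℂ)) = ((1 / (W x - 1 - S x) : ℝ) : ℂ) := fun x hx =>
    ⟨tsum_ofReal_pow_smul (hser x (sub₀ hx)).1, tsum_ofReal_pow_smul (hser x (sub₀ hx)).2.2.2.2.2.2⟩
  refine ⟨ρ, hρpos, hρρ₀.trans hρ₀1, hxη, hη0, hκ, hκ', fun x hx => hne x (sub₀ hx), max Cb₁ (Cs * C₀),
    le_max_of_le_left hCb₁, ⟨fun x => ∑' n, (x : ℂ) ^ n • ((e 0 n : ℝ) : ℂ), fun x => ∑' n, (x : ℂ) ^ n • ((e 6 n : ℝ) : ℂ),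
      hι₁C.mono subθ, hι₂C.mono subθ, hιeq, fun i hi x hx => ⟨(hι₁b i hi x (subθ hx)).trans (le_max_right _ _),
      (hι₂b i hi x (subθ hx)).trans (le_max_right _ _)⟩⟩, fun Λ hΛ hgapΛ => ?_⟩
  -- the data of the abstract theorem for this `Λ`
  obtain ⟨e', he'⟩ : ∃ e' : Fin 6 → ℕ → ℝ, e' = ![e 0, e 1, e 2, e 3, e 4, e 5] := ⟨_, rfl⟩
  have he'b : ∀ i n, |e' i n| ≤ C₀ * θ ^ n := by
    intro i n; fin_cases i <;> simp [he'] <;> exact he _ n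
  have hE : ∀ n, e' 0 n = e 0 n ∧ e' 1 n = e 1 n ∧ e' 2 n = e 2 n ∧ e' 3 n = e 3 n ∧ e' 4 n = e 4 n ∧ e' 5 n = e 5 n :=
    fun n => by simp [he']
  have hv0 : e' 0 0 = 1 / (-κ) := by simp [he', e00, hηκ]
  have hv2 : e' 2 0 = b₀ / (-κ) := by simp [he', e20, hηκ, hb₀]; ring
  have hv3 : e' 3 0 = (deriv W 0 / 3 + deriv S 0 + 2 * S 0) / (-κ) := by simp [he', e30, hηκ]
  have hv1 : e' 1 0 = 0 := by simp [he', e10]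
  have hv4 : e' 4 0 = 0 := by simp [he', e40]
  have hv5 : e' 5 0 = 0 := by simp [he', e50]
  -- the exponent
  have hκC : ((-κ : ℝ) : ℂ) ≠ 0 := by exact_mod_cast (by linarith : (-κ : ℝ) ≠ 0)
  have hνeq : Λ * (e' 0 0 : ℂ) - (e' 2 0 : ℂ) = (((b₀ : ℝ) : ℂ) - Λ) / ((κ : ℝ) : ℂ) := by
    rw [hv0, hv2]; push_cast; field_simp; ring
  have hν' : Λ * (e' 0 0 : ℂ) - (e' 2 0 : ℂ) = (((b₀ : ℝ) : ℂ) - Λ) / ((-(deriv W 0 + deriv S 0) : ℝ) : ℂ) := by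
    rw [hνeq, hκ_def]
  have hμ : ∀ n : ℕ, μ ≤ ‖(n : ℂ) - (Λ * (e' 0 0 : ℂ) - (e' 2 0 : ℂ))‖ ∧
      μ ≤ ‖(n : ℂ) + (Λ * (e' 0 0 : ℂ) - (e' 2 0 : ℂ))‖ := by
    intro n; rw [hν', hb₀]; exact hgapΛ n
  have hνM : ‖Λ * (e' 0 0 : ℂ) - (e' 2 0 : ℂ)‖ ≤ (|b₀| + max R 0) * (5 / 2) := by
    rw [hνeq, norm_div, Complex.norm_real, Real.norm_eq_abs, abs_of_pos hκpos, div_le_iff₀ hκpos]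
    calc ‖((b₀ : ℝ) : ℂ) - Λ‖ ≤ ‖((b₀ : ℝ) : ℂ)‖ + ‖Λ‖ := norm_sub_le _ _
      _ ≤ |b₀| + max R 0 := by rw [Complex.norm_real, Real.norm_eq_abs]; exact add_le_add le_rfl (hΛ.trans (le_max_left _ _))
      _ = (|b₀| + max R 0) * (5 / 2) * (2 / 5) := by ring
      _ ≤ (|b₀| + max R 0) * (5 / 2) * κ := by gcongr
  have hb : |e' 3 0| ≤ 15 / 4 := by
    rw [hv3, abs_div, abs_neg, abs_of_pos hκpos, div_le_iff₀ hκpos]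
    calc _ ≤ (3 / 2 : ℝ) := hbpm
      _ = 15 / 4 * (2 / 5) := by norm_num
      _ ≤ 15 / 4 * κ := by gcongr
  obtain ⟨a₁, a₂, ψ₁, ψ₂, χ, ha₁, ha₂, hψ₁, hψ₂, hχ, ha₂0, hψ₁0, hψχ, hode, hW, hbd⟩ :=
    hpair e' Λ he'b (hΛ.trans (le_max_left _ _)) hμ hνM hb hv1 hv4 hv5
  refine ⟨a₁, a₂, ψ₁, ψ₂, χ, ha₁.mono sub₁, ha₂.mono sub₁, hψ₁.mono sub₁, hψ₂.mono sub₁, hχ.mono sub₁, ha₂0, hψ₁0,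
    fun x hx => hψχ x (sub₁ hx), fun x hx => ?_, fun x hx => hW x (sub₁ hx), fun i hi x hx => ?_⟩
  · -- the equations at `x`: feed the summed coefficients
    obtain ⟨t0, t1, t2, t3, t4, t5, -⟩ := hser x (sub₀ hx)
    have c0 := hasSum_ofReal_pow t0; have c1 := hasSum_ofReal_pow t1; have c2 := hasSum_ofReal_pow t2
    have c3 := hasSum_ofReal_pow t3; have c4 := hasSum_ofReal_pow t4; have c5 := hasSum_ofReal_pow t5
    obtain ⟨hηx, hcmx⟩ := hne x (sub₀ hx)
    have hηC : ((dslope (fun y => W y - 1 + S y) 0 x : ℝ) : ℂ) ≠ 0 := Complex.ofReal_ne_zero.2 hηx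
    have hcC : ((W x - 1 - S x : ℝ) : ℂ) ≠ 0 := Complex.ofReal_ne_zero.2 hcmx.ne
    have m₁₁ : HasSum (fun n => (x : ℂ) ^ n * (Λ * (e' 0 n : ℂ) - (e' 2 n : ℂ)))
        ((Λ - ((2 / 3 * deriv W x + 2 * W x - r + 2 * deriv S x + 4 * S x : ℝ) : ℂ)) /
          ((dslope (fun y => W y - 1 + S y) 0 x : ℝ) : ℂ)) := by
      have h := (c0.mul_left Λ).sub c2
      have hv : Λ * (((1 / dslope (fun y => W y - 1 + S y) 0 x : ℝ)) : ℂ) -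
          (((2 / 3 * deriv W x + 2 * W x - r + 2 * deriv S x + 4 * S x) / dslope (fun y => W y - 1 + S y) 0 x : ℝ) : ℂ) =
          (Λ - ((2 / 3 * deriv W x + 2 * W x - r + 2 * deriv S x + 4 * S x : ℝ) : ℂ)) /
            ((dslope (fun y => W y - 1 + S y) 0 x : ℝ) : ℂ) := by push_cast; ring
      rw [hv] at h
      refine h.congr_fun fun n => ?_
      rw [(hE n).1, (hE n).2.2.1]; ring
    have m₁₂ : HasSum (fun n => (x : ℂ) ^ n * (-(e' 3 n : ℂ)))
        (-((deriv W x / 3 + deriv S x + 2 * S x : ℝ) : ℂ) / ((dslope (fun y => W y - 1 + S y) 0 x : ℝ) : ℂ)) := by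
      have h := c3.neg
      have hv : -((((deriv W x / 3 + deriv S x + 2 * S x) / dslope (fun y => W y - 1 + S y) 0 x : ℝ)) : ℂ) =
          -((deriv W x / 3 + deriv S x + 2 * S x : ℝ) : ℂ) / ((dslope (fun y => W y - 1 + S y) 0 x : ℝ) : ℂ) := by
        push_cast; ring
      rw [hv] at h
      refine h.congr_fun fun n => ?_
      rw [(hE n).2.2.2.1]; ring
    have m₂₁ : HasSum (fun n => (x : ℂ) ^ n * (-(e' 4 n : ℂ)))
        (-(x : ℂ) * ((deriv W x / 3 - deriv S x - 2 * S x : ℝ) : ℂ) / ((W x - 1 - S x : ℝ) : ℂ)) := by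
      have h := c4.neg
      have hv : -(((x * (deriv W x / 3 - deriv S x - 2 * S x) / (W x - 1 - S x) : ℝ)) : ℂ) =
          -(x : ℂ) * ((deriv W x / 3 - deriv S x - 2 * S x : ℝ) : ℂ) / ((W x - 1 - S x : ℝ) : ℂ) := by push_cast; ring
      rw [hv] at h
      refine h.congr_fun fun n => ?_
      rw [(hE n).2.2.2.2.1]; ring
    have m₂₂ : HasSum (fun n => (x : ℂ) ^ n * (Λ * (e' 1 n : ℂ) - (e' 5 n : ℂ)))
        ((x : ℂ) * (Λ - ((2 / 3 * deriv W x + 2 * W x - r - 2 * deriv S x - 4 * S x : ℝ) : ℂ)) / ((W x - 1 - S x : ℝ) : ℂ)) := by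
      have h := (c1.mul_left Λ).sub c5
      have hv : Λ * (((x / (W x - 1 - S x) : ℝ)) : ℂ) -
          (((x * (2 / 3 * deriv W x + 2 * W x - r - 2 * deriv S x - 4 * S x) / (W x - 1 - S x) : ℝ)) : ℂ) =
          (x : ℂ) * (Λ - ((2 / 3 * deriv W x + 2 * W x - r - 2 * deriv S x - 4 * S x : ℝ) : ℂ)) / ((W x - 1 - S x : ℝ) : ℂ) := by
        push_cast; ring
      rw [hv] at h
      refine h.congr_fun fun n => ?_
      rw [(hE n).2.1, (hE n).2.2.2.2.2]; ring
    have hν : Λ * (e' 0 0 : ℂ) - (e' 2 0 : ℂ) = (((b₀ : ℝ) : ℂ) - Λ) / ((-(deriv W 0 + deriv S 0) : ℝ) : ℂ) := by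
      rw [hνeq, hκ_def]
    rw [hb₀] at hν
    obtain ⟨hA, hΨ⟩ := hode x (sub₁ hx) _ _ _ _ m₁₁ m₁₂ m₂₁ m₂₂
    rw [hν] at hΨ
    exact ⟨hA, hΨ⟩
  · obtain ⟨b1, b2, b3, b4, b5⟩ := hbd i hi x (sub₁ hx)
    exact ⟨b1.trans (le_max_left _ _), b2.trans (le_max_left _ _), b3.trans (le_max_left _ _), b4.trans (le_max_left _ _),
      b5.trans (le_max_left _ _)⟩


end Summit.AtomisticToContinuum.HydrodynamicLimit.Theorems.SonicCavityRenewal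

end
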